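import Summits.CriticalPhenomena.Ising3DConformalLimit.Theorems.PerfectScreeningGaussianLimitNotScreenedFatSpreadCluster
import HarnessLib
import HarnessLib.Audit

/-!
# Line `karamata-amplitude-blind-merging` for crux `GaussianLimitNotScreened`
# (stmt-CriticalPhenomena-13886, route PerfectScreening r4) — FINAL SKELETON OF CYCLE 1 (2 open stubs)

STATE (lead prover-line-stmt-CriticalPhenomena-13886-0, 2026-08-16 13:00Z): everything provable is LANDED and imported through
`Theorems/PerfectScreeningGaussianLimitNotScreenedFatSpreadCluster.lean` (p102368: `stub_fatSpreadCluster`, `twoCurrentMeet_lower_of_capacity`,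
`hasNontrivialU4_of_lt_threeQuarters_of_capacity`, `gaussianLimitNotScreened_of_capacity_of_corner`, `…_of_windowBelowHalf`, corner
bridges; it imports Defs p85913, DepletionBound p89777, DyadicShellSums p86861, OneArmAsymptotics p93865, ClusterMomentsBox p99612).
This file is now only: the two OPEN registered stubs + the one-line composition. To close the crux: prove `stub_isingCapacity`
(open heart; lead's assessment: crux-sized, no rigorous handle — item evidence capacity-assessment.md) and `stub_noMarginalGaussianLimit`
(= items stmt-5507 / stmt-2601 via the landed bridges), then land this file `--workitem stmt-CriticalPhenomena-13886`.

HISTORY OF THE LINE (planner's text, kept):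

CHECKED SKELETON (crux-plan; planner-cruxplan-stmt-CriticalPhenomena-13886-karamata-amplitude-b-0,
2026-08-16). Idea card `Cruxes/GaussianLimitNotScreened/Ideas/karamata-amplitude-blind-merging.md`
(crux-ideate r1 k=2; triage r1: pass ×3, representative of the merged trio
karamata ≈ amplitude-free-second-moment ≈ free-regular-variation-dcp-window), planned in the
θ-FREE DEPLETION FORM that all three triagers asked for (card §E2 = ADC21 Lemma A.1 read as an
equality), with the capacity input RE-TYPED (energy-Frostman "spread defects") so that none of the
recorded counterexamples (∃c-vacuity, dilute dusts, clumps — TRIAGE-r1-2 and TRIAGE-r1-3) applies, and with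
`SingleDouble` kept OUT of the load-bearing chain (triage F4: θ_eff ≈ 0.24, predicted false).

THE CRUX. `∀ ρ Δ S, ρ > 0 on (0,1] → HasPointwiseScalingLimit (criticalCorr 3) ρ S →
IsNondegenerateTwoPoint S → IsMoebiusCovariant Δ S → ¬ HasNontrivialU4 S → ¬ (‖x‖ G(x) → 0)`.
Anatomy (landed, `Negative/Reformulation.lean`: `dimension_window_and_eta`, `screened_of_half_lt`,
`crux_iff_half_and_amplitude`): `Δ ∈ [1/2, 3/4]`, and the crux ⇔ "no non-degenerate Möbius GAUSSIAN
limit on (1/2, 3/4], and at Δ = 1/2 such a limit is not screened". The line proves the STRONGER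
`C⁺`: no non-degenerate Möbius Gaussian limit at all — on `[1/2, 3/4)` by an amplitude-blind
lattice engine, at the marginal point `Δ = 3/4` by a residual stub.

THE LINE (finite volume throughout: free box `Λ_L ⊂ ℤ³` at `β_c(3)`, vocabulary of the LANDED
Defs/FatStep files of crux 0636 — `lat`, `boxG`, `twoCurrentMeet = P²`, `ScaleCovariantOn`; the
volume `Λ_L ↑ ℤ³` is taken after the mesh `δ` is fixed). Write `x̃ᵢ = [xᵢ/δ]`,
`P² = P^{x̃₀x̃₁,x̃₂x̃₃}_{Λ_L}[x̃₀ ↔ x̃₂ in n₁+n₂] = −U₄,Λ/(2⟨σσ⟩⟨σσ⟩)` (proved box identity).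
* KARAMATA FRONT END (the card's FL1–FL3; now TREE THEOREMS, imported not re-stubbed — triage F1):
  under `hlim + hnd + hρ + scale covariance` the two-point function is regularly varying of index
  `−2Δ` in every direction with `Δ ∈ [1/2, 3/4]` (`dimension_window_and_eta`,
  `HasPointwiseScalingLimit.exists_rpow_scale_mem_Icc_threeQuarters`, `two_point_ratio_asymptotics`),
  and every lattice sum `∑_{|w| ≤ R} |w|^{−a} G(w)^b` with Karamata index `2 − a − 2bΔ > −1` is
  `≍ R³⁻ᵃ G(R)ᵇ` for EVERY slowly varying amplitude — the amplitude `ℓ(R) = R·G(Re₁)` that the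
  crux is about CANCELS in every ratio below (this is what "Karamata pays" means; the four-current
  instance, the fat step `P⁴ ≥ c` for `Δ < 3/4`, is the landed `stub_fatStep`).
* RESHAPE BY THE LINE LEAD (prover-line-stmt-CriticalPhenomena-13886-0, 2026-08-16, cycle 1): the planner's
  `stub_fatSpreadCluster` (L) is split at the skeleton level into the finite-volume probability step
  (`stub_clusterMomentsBox`), the Karamata dyadic sums (`stub_dyadicShellSums`) and the moment
  asymptotics on the counting region (`stub_oneArmAsymptotics`), composed here SORRY-FREE into
  `fatSpreadCluster_of_stubs` (verbatim the old stub's statement); plus the bookkeeping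
  `stub_vocabulary` through which the line's `…Defs` file lands. Registered stubs (7 = stubs_max):
  `stub_vocabulary`, `stub_depletionBound`, `stub_clusterMomentsBox`, `stub_dyadicShellSums`,
  `stub_oneArmAsymptotics`, `stub_isingCapacity` (hardest, held by the lead), `stub_noMarginalGaussianLimit`.
* STUB 1 `stub_depletionBound` (M, provable now): ADC21 Lemma A.1 AS AN EQUALITY, transported to the
  box: `1 − P² = E^{x̃₀x̃₁,∅}_{Λ_L}[𝟙{x̃₂,x̃₃ ∉ C}·⟨σ_{x̃₂}σ_{x̃₃}⟩_{Λ_L∖C}/⟨σ_{x̃₂}σ_{x̃₃}⟩_{Λ_L}]`,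
  `C = C_{n₁+n₂}(x̃₀)` the SOURCED DOUBLE-current cluster (tree identity
  `Current.tsum_epairWeight_eq_tsum_mul_offRatio` + Griffiths `Current.offRatio_pair_mul_le`; dictionary
  `isingTwoPoint_compl_eq_offGraph_univ`, `isingTwoPoint_free_map`, `ecurrentSumIn_offGraph_eq_cutCoupling`;
  the same dictionary is the registered `stub_screeningIdentity` of crux 4468's line
  `screening-form-lemma-a1`, importable if it lands first); typed in the consequence form the composition
  consumes: if every set of a class `𝒫` depletes `⟨σ_{x̃₂}σ_{x̃₃}⟩` by the factor `1 − c'`, then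
  `P² ≥ c'·P^{x̃₀x̃₁,∅}[𝒫(C)]`.
* STUB 2a `stub_clusterMomentsBox` (M, provable now): Paley–Zygmund ∧ Markov in the box —
  `P^{ab,∅}_{Λ_L}[#(C(a)∩A) ≥ m ∧ I_s(C(a)∩A) ≤ t] ≥ (M₁ − m)²/M₂ − E_s/t` with the EXACT first moment
  `M₁` (switching), the Prop. A.3 second moment `M₂` and energy moment `E_s` (`oneArmMoment₁/₂`,
  `energyMoment`; transport as in the landed `stub_secondMomentBox`).
* STUB 2b `stub_dyadicShellSums` (M, provable now): `∑_{0<‖u‖≤2^{J+2}} ‖u‖^{−s}G(u) ≤ K 8^J 2^{−sJ} G(2^Je₀)`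
  for `J ≥ i₀`, `0 ≤ s < 3 − 2Δ` (the landed `stub_momentRatioBubble` is the `G²` case).
* STUB 2c `stub_oneArmAsymptotics` (L, provable now): on the counting region `A(δ)` of the landed
  `stub_momentRatioLowerBound` (window `stub_momentRatioWindow` imported), `M₁² ≥ c₁M₂ > 0`,
  `E_s ≤ c₂R^{−s}M₁²` (2b), `2Rˢ ≤ M₁` (η exists), `A(δ)` in the `KR`-ball of `x̃₂` avoiding `x̃₂,x̃₃`.
  ⇒ `fatSpreadCluster_of_stubs` (PROVED here): for every `s < 3 − 2Δ`, with probability `≥ c₁/8` the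
  double cluster of `x̃₀` contains a SPREAD `s`-DIMENSIONAL DEFECT relative to `(x̃₂, x̃₃)`
  (`IsSpreadDefect`: inside the `K R`-ball, `#C ≥ ν Rˢ`, Riesz `s`-energy `≤ λ R^{−s} #C²`).
* STUB 3 `stub_isingCapacity` (XL — THE OPEN HEART; deterministic, crux-independent): for `s > 3/2`
  every spread `s`-dimensional FREE DEFECT depletes the transverse critical two-point function by a
  definite fraction, `⟨σ_cσ_e⟩_{Λ_L∖C} ≤ (1 − c')⟨σ_cσ_e⟩_{Λ_L}`. Physics: a free defect couples to
  the energy operator, so it is RELEVANT iff `s > Δ_ε` (`Δ_ε(3) = 1.4126 < 3/2 ⇔ ν < 2/3`); the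
  typed threshold `3/2` is the crux's own window edge (`3 − 2Δ > 3/2 ⇔ Δ < 3/4`). Rigorously known:
  only `Δ_ε ≥ 2Δ_σ > 1` (Lebowitz) and Griffiths `c' ≥ 0`. Cheapest falsifier: Swendsen–Wang MC of
  the PLATE special case (triage r1-2 `MacroscopicDiscDepletion`) and of sampled double clusters.
* STUB 4 `stub_noMarginalGaussianLimit` (residual corner `Δ = 3/4`, `η = 1/2`; engine-less here —
  the catalogued marginal block `LongRangeTrivialityOnZ3MarginalAudit`, triage F3): discharged by
  EITHER existing item — stmt-CriticalPhenomena-2601 `AnomalousForcesInteraction.GaussianLimitIsFree`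
  (`noMarginalGaussianLimit_of_gaussianLimitIsFree`, proved below) or "η(3) ≠ 1/2"
  (`noMarginalGaussianLimit_of_eta_ne_half`, proved below; item stmt-CriticalPhenomena-5507
  `LatticeSDPCertificates.WindowBelowHalf` gives it: `eta_ne_half_of_windowBelowHalf`, proved below).
* COMPOSITION (kernel-checked, `GaussianLimitNotScreened_of`): `Δ ∈ [1/2,3/4]` by the window theorem;
  if `Δ < 3/4` pick `s ∈ (3/2, 3 − 2Δ)`: STUB 2 gives the spread sub-defect w.p. `≥ c`, STUB 3 +
  Griffiths volume monotonicity (`isingTwoPoint_free_le_of_subset`) give the depletion of every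
  cluster containing one, STUB 1 turns this into `P² ≥ c'c`, and the landed
  `hasNontrivialU4_of_twoCurrentMeet_lower` into `U₄^S ≢ 0` — contradiction with the Gaussian
  hypothesis; if `Δ = 3/4`, STUB 4. (The screening hypothesis is never used: the line proves `C⁺`.)
* LOGICAL POSITION (not a theorem of this file, so that exactly ONE declaration concludes the crux by
  name): 13886 ⇐ C⁺ ⇐ item stmt-CriticalPhenomena-0636 `IsingEuclidUpgradeR4NonGaussian`
  (`fun h ρ Δ S hρ hlim hnd hM hU4 _ => hU4 (h ρ S hρ hlim hnd)`); conversely STUBS 1–3 prove 0636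
  restricted to scale-covariant limits with `Δ < 3/4` (`hasNontrivialU4_of_lt_threeQuarters`).

DISPROOF USED (`Cruxes/GaussianLimitNotScreened/Disproof.lean` v4 + landed `Negative/ModelBlind`,
`Negative/Reformulation`; read 2026-08-16): `cruxWithoutIsing_false` / `cruxWithoutIsingSharp_false` /
`cruxWithoutIsing_false'` (the MODEL-BLIND crux is false: screened Wick/hafnian witness → free field)
— honoured: STUBS 1–3 are statements about random currents and free defects OF THE NEAREST-NEIGHBOUR
ISING MEASURE (switching lemma, Lemma A.1, GKS), void for a Wick family; in the disprover's words the
line uses "a property of the critical Ising MEASURE not in the list" at STUB 3 (depletion by free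
defects = the `ε`-channel) and at STUB 1 (the current representation of `U₄`). `not_halfOne_blind` /
`not_halfTwo_blind` (each half needs the Ising measure) — honoured the same way; the amplitude half
(ii) is NOT attacked through any amplitude statement (`renorm_not_canonical`: the screening sits in
the slowly varying factor of `ρ`, which CANCELS here). Mutation lemmas (item evidence): `hnd` is
consumed by `hasNontrivialU4_of_twoCurrentMeet_lower` and by the window, `hlim` by STUB 2 and the
window. Refuted strengthenings `not_noGaussianMoebiusFamily`, `not_coulombWithoutIsing`: not
instances of any stub (no stub is lattice-free; none concludes a Coulomb bound or `¬Screened`).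
`crux_iff_half_and_amplitude` / `screened_of_half_lt`: the composition's case split IS this anatomy.
`ledger negatives --problem CriticalPhenomena`: none on this sub-problem's clause (iii).
-/

noncomputable section

open Filter Topology Set Function MeasureTheory Finset
open Literature.Probability.LatticeModels Literature.Probability.Percolation
open Summit.CriticalPhenomena.Ising3DConformalLimit.Cruxes.IsingEuclidUpgradeR4NonGaussian.FreeCovarianceDeltaDichotomy
  (lat boxG)
open scoped symmDiff

namespace Summit.CriticalPhenomena.Ising3DConformalLimit.Cruxes.GaussianLimitNotScreened.KaramataAmplitudeBlindMerging

/-! ## The two open registered stubs -/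

/-- **STUB 3 — ISING CAPACITY OF SPREAD FREE DEFECTS (XL; THE OPEN HEART of the line; a
deterministic statement about the critical nearest-neighbour Ising₃ model, independent of the crux's
hypotheses).** For every `s > 3/2` and `K, λ, ν > 0` there are `c' ∈ (0,1]` and `R₀` such that for
every pair `(c, e)` with `‖c − e‖ ≥ R₀`, for all large `L`, EVERY spread `s`-dimensional defect `C`
(`IsSpreadDefect s K λ ν c e C`) avoiding `c, e` depletes: `⟨σ_cσ_e⟩_{Λ_L∖C,β_c} ≤ (1 − c')⟨σ_cσ_e⟩_{Λ_L,β_c}`.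
WHY TRUE (physics, not a proof): removing the couplings at `C` is the perturbation `+J∑_{∂C}σσ`, a
coupling to the ENERGY operator `ε` supported on an `s`-dimensional spread set, of RG eigenvalue
`s − Δ_ε`; it is relevant, and drives the defect to the fully decoupling fixed point (depletion
`O(1)`), iff `s > Δ_ε(3) ≈ 1.4126` — and `3/2 > Δ_ε ⇔ ν(3) < 2/3` (`ν = 0.6300`); depletion is
MONOTONE in `C` (Griffiths), so spread sets are handled through their dilute sub-dusts
(`n` isolated sites at distance `≍ R` deplete additively by `≍ n R^{−Δ_ε}` while dilute), and the
energy condition forbids hiding the mass in irrelevant clumps (a clump of radius `r` acts as ONE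
`ε`-insertion of strength `(r/R)^{Δ_ε}`). Consistency checks: the dust (`N ≍ R^{1.04}` isolated
sites, `s = 1.04`), line (`s = 1`) and clump families that killed the ideator's `IsingCapacity`
(TRIAGE-r1-2 and TRIAGE-r1-3) violate `#C ≥ νRˢ, s > 3/2` or the energy bound; the plate (`s = 2`,
`MacroscopicDiscDepletion` of TRIAGE-r1-2) and the double cluster (`s = 2 − η`) satisfy them.
WHY OPEN: any proof must see `ε`-relevance quantitatively — a LOWER bound on the `σσε` response
`⟨σ_cσ_e;ε_u⟩ ≳ R^{−Δ_ε}⟨σ_cσ_e⟩` with `Δ_ε < 3/2` and its additivity over dilute dusts; the tree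
has only the opposite inequalities (GKS `c' ≥ 0`; Lebowitz `Δ_ε ≥ 2Δ_σ`; Simon–Lieb loses `R^{1−η}`).
In a hypothetical Gaussian world with dimension `Δ` one has `Δ_ε = 2Δ`, so the statement at
`s < 3 − 2Δ` is exactly as strong as `Δ < 3/4` — it FAILS in the marginal world `Δ = 3/4`, which is
why STUB 4 exists. Cheapest falsifier: Swendsen–Wang MC at `β_c(3)`, `L = 32…128`: (i) the free
square plate of side `R/2` in the mid-plane between `c, e = ∓(R/2)e₂` (depletion must stay `≥ c'`);
(ii) spread random dusts with `N = Rˢ`, `s ∈ {1.3, 1.6, 1.9}` (depletion must → 0 / stay bounded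
below across `s = Δ_ε`); (iii) sampled double clusters (card's sampler `singledouble.py`).
[cite: AizenmanDuminilCopinAnnals2021, App. A Lemma A.1 (restricted states, Griffiths monotonicity)]
[cite: PolandRychkovVichi2019, §II (Δ_ε = 1.412625, Δ_σ = 0.5181489)] -/
theorem stub_isingCapacity :
    ∀ s : ℝ, 3 / 2 < s → ∀ K lam nu : ℝ, 0 < K → 0 < lam → 0 < nu →
      ∃ c' : ℝ, 0 < c' ∧ c' ≤ 1 ∧ ∃ R₀ : ℝ, ∀ c e : Site 3, R₀ ≤ ‖c - e‖ →
        ∀ᶠ L : ℕ in atTop, ∀ C : Finset (Site 3), c ∉ C → e ∉ C →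
          IsSpreadDefect s K lam nu c e C → defectG L C c e ≤ (1 - c') * boxG L c e := by
  sorry

/-- **STUB 4 — NO MARGINAL GAUSSIAN LIMIT (the residual corner `Δ = 3/4`, i.e. `η = 1/2`; size:
open, engine-less in this line).** A non-degenerate pointwise scaling limit of `criticalCorr 3` that is
Möbius covariant with the MARGINAL dimension `3/4` has `U₄ ≢ 0`. This is the catalogued marginal block
(`Literature/Barriers/CriticalPhenomena/LongRangeTrivialityOnZ3MarginalAudit`: the profile
`G ≍ |x|^{−3/2}` saturates every printed n.n. two-point theorem — DCP25 Thm 1.5 gives only `η ≤ 1/2`).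
It is discharged by EITHER existing item: stmt-CriticalPhenomena-2601
`AnomalousForcesInteraction.GaussianLimitIsFree` (a Gaussian translation-invariant scale-covariant
limit has `Δ = 1/2`; `noMarginalGaussianLimit_of_gaussianLimitIsFree` below) or `η(3) ≠ 1/2`
(`noMarginalGaussianLimit_of_eta_ne_half` below), in particular by stmt-CriticalPhenomena-5507
`LatticeSDPCertificates.WindowBelowHalf` (`eta_ne_half_of_windowBelowHalf` below).
[cite: DuminilCopinPanis2025LowerBounds, Theorem 1.5 (η ≤ 1/2 if it exists)]
[cite: Panis2023Triviality, Theorem 1.2 (the α = 3/2 marginal line)] -/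
theorem stub_noMarginalGaussianLimit :
    ∀ (ρ : ℝ → ℝ) (S : CorrFamily 3), (∀ δ ∈ Set.Ioc (0:ℝ) 1, 0 < ρ δ) →
      HasPointwiseScalingLimit (criticalCorr 3) ρ S → IsNondegenerateTwoPoint S →
      IsMoebiusCovariant (3 / 4) S → HasNontrivialU4 S := by
  sorry

/-! ## The composition: the two stubs ⇒ the crux, BY NAME (everything else is the landed FatSpreadCluster file) -/

/-- **`GaussianLimitNotScreened` from the two open stubs — THE SKELETON THEOREM.** The landed conditional assembly
`gaussianLimitNotScreened_of_capacity_of_corner` (window `Δ ∈ [1/2,3/4]`; below `3/4`: fat spread cluster × Ising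
capacity × depletion bound × Aizenman's criterion ⇒ `U₄^S ≢ 0`; at `3/4`: the corner) fed with the two stubs.
[cite: AizenmanDuminilCopinAnnals2021, eq. (3.11), Lemma 4.4 and App. A Lemma A.1] -/
theorem GaussianLimitNotScreened_of :
    Summit.CriticalPhenomena.Ising3DConformalLimit.Theses.PerfectScreening.GaussianLimitNotScreened :=
  gaussianLimitNotScreened_of_capacity_of_corner stub_isingCapacity stub_noMarginalGaussianLimit

end Summit.CriticalPhenomena.Ising3DConformalLimit.Cruxes.GaussianLimitNotScreened.KaramataAmplitudeBlindMerging

end
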